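import Mathlib
import Summits.ResolutionOfSingularities.ResolutionOfSingularities.Theorems.WeightedInvariantLocalWeightedDropNCTameBinomialRung
import Summits.ResolutionOfSingularities.ResolutionOfSingularities.Theorems.WeightedInvariantLocalWeightedDropNCTameBinomialRungClosed
import Summits.ResolutionOfSingularities.ResolutionOfSingularities.Theorems.WeightedInvariantLocalWeightedDropNCGameToricStep
import Summits.ResolutionOfSingularities.ResolutionOfSingularities.Theorems.WeightedInvariantLocalWeightedDropNCGameToricEnd
import Summits.ResolutionOfSingularities.ResolutionOfSingularities.Theorems.WeightedInvariantLocalWeightedDropTameN4SupportClasses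

/-!
# `WeightedInvariant.LocalWeightedDrop`, residual T″|₄ `stub_tameWideApexFourStartsWon` (skeleton v31): (K-c) — TAME SUSPENSIONS and
# `x₂`-BINOMIALS OVER THE PLANE are finitely NC-winnable; double points over them are won; the post-R6 census specimen
# `y² + x₂³ + (x₀² − x₁³)²` is `Won k 4`

Crux item stmt-ResolutionOfSingularities-8899 `LocalWeightedDrop` (route `ResolutionOfSingularities/WeightedInvariant`), engine skeleton v31
(res-L1-w43-lead-1), residual T″|₄ = `stub_tameWideApexFourStartsWon`.  [OURS · L1 W4.3, chain w43, res-L1-w43-stub-2 (gen 4) = piece (K-c)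
`TameN4.tot_suspension_tame` of res-L1-w43-stub-1's `N4-TAME-CENSUS.md` v1.1 §(iv) (dealer res-L1-w43-plan-1, DEALS gen 10 #3 (3) / #4 (1)).  The
mathematics is TOT rung R7 «tame relative binomials» of res-L1-w43-strat-1 (`tot_rung_r7_sketch.lean`, adopted verbatim by res-D-pv-006 /
res-D-pv-036 as `…NCTameBinomialEndGame` / `…NCTameBinomialRung` / `…NCTameBinomialRungClosed`: `NCTransport.exists_winsIn_relBinom`,
`exists_winsIn_tameSuspension`, `orderGrowth`) over rung R6 (`NCTransport.toricStep`, p523576; `NCTransport.toricEnd`, p521013) and the plane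
count `NCTransport.winsIn_plane`; the Won-level corollaries go through res-L1-w43-stub-3's F-D `TameN4.won_doublePoint_of_winsIn` (p525631) over
res-L1-w43-stub-1's relative multiplicity lift.  This file is the census-shaped WRAPPER; nothing here is a statement of H. Hironaka's manuscript;
the games are the programme's own; AI-written, gate-accepted means sorry-free with standard axioms, not refereed.  Definition-free.]

* (i) **`tot_suspension_tame`** (census §(iv) binder shape): `k` algebraically closed of characteristic `p`, `c(x₀,x₁) ≠ 0`, `m` invertible in
  `k` ⇒ `∃ n, WinsIn (m := 2) GermIsNC n (x₂ ^ m + c)` — HYPOTHESIS-FREE.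
* (i′) **`tot_relBinomial_plane`**: the same for EVERY `x₂`-binomial over the plane `E(x₀,x₁)·(M(x₀,x₁)·x₂^d + h(x₀,x₁))`, `E, M, h ≠ 0`, `d`
  invertible in `k` (R7 at `m = 1`; its hypothesis «`E·M·h` finitely NC-winnable» is free by `winsIn_plane`).
* (ii) **`won_four_doublePoint_suspension`** (`y² + x₂^m + c`, char `≠ 2`, `m ≥ 2` tame, `ord c ≥ 2`) and **`won_four_doublePoint_relBinomial`**
  (`y² + E·(M·x₂^d + h)`) are `Won k 4`; **`specimen_suspendedCusp_won`**: for `p ≥ 5`, `y² + x₂³ + (x₀² − x₁³)²` — the census's first start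
  uncovered after R6 (singular along a cuspidal curve, Newton-degenerate, not a cylinder / product / arrangement) — is `Won k 4`.
Helpers: `order_X_pow'`, `le_order_rename_castSucc`, `suspension_ne_zero`, `two_le_order_suspension`, `two_not_mem_range_castSuccEmb`,
`relBinomial_plane_ne_zero` (Mathlib's `killCompl`), `order_cuspSq`.
-/

set_option linter.dupNamespace false -- mandated namespace of this single-conjunct summit
set_option autoImplicit false

namespace Summit.ResolutionOfSingularities.ResolutionOfSingularities.Theorems

open Literature.AlgebraicGeometry.Resolution
open Literature.AlgebraicGeometry.Resolution.CobordantGame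

namespace TameN4

open MvPowerSeries TameFourTupleDrop NCTransport CobordantGame

variable {k : Type} [Field k]

/-! ## The count-game statements: tame suspensions and `x₂`-binomials over the plane -/

/-- **(K-c) THE TAME SUSPENSION IS FINITELY NC-WINNABLE** (N = 4 tame census §(iv), binder shape of the census; OURS · L1 W4.3):
over an algebraically closed field of characteristic `p`, for every non-zero plane germ `c(x₀,x₁)` and every exponent `m` invertible in `k`,
the mover of the NC count game in three variables wins the suspension `x₂ ^ m + c(x₀,x₁)` within finitely many rounds.  This is TOT rung R7
(`NCTransport.exists_winsIn_tameSuspension`, tame relative binomials at `m = 1`, `E = M = 1`; res-L1-w43-strat-1, landed by res-D-pv-036) made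
hypothesis-free by res-D-pv-036's closer `NCTransport.exists_winsIn_tameSuspension_of_isUnit` (rung R6 `toricStep 2` / `toricEnd 2` of res-D-pv-006 /
res-type-088 and the order-growth lemma (O) `orderGrowth 2`) — this is the census-shaped namespace wrapper. -/
theorem tot_suspension_tame : ∀ (p : ℕ) (_ : p.Prime) (k : Type) [Field k] [CharP k p] [IsAlgClosed k] (m : ℕ)
    (c : MvPowerSeries (Fin 2) k), c ≠ 0 → IsUnit ((m : ℕ) : k) →
    ∃ n, WinsIn (m := 2) GermIsNC n (X 2 ^ m + rename Fin.castSucc c) :=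
  fun _ _ _ _ _ _ _ c hc hm => exists_winsIn_tameSuspension_of_isUnit hm c hc

/-- **(K-c′) `x₂`-BINOMIALS OVER THE PLANE ARE FINITELY NC-WINNABLE**: for non-zero plane germs `E, M, h` and an exponent `d` invertible
in `k`, the mover of the NC count game in three variables wins `E(x₀,x₁)·(M(x₀,x₁)·x₂^d + h(x₀,x₁))` within finitely many rounds — TOT rung
R7 (`NCTransport.exists_winsIn_relBinom` at `m = 1`, right block of size one) over the plane count `winsIn_plane` (EVERY non-zero plane germ
is finitely NC-winnable, so the rung's hypothesis on `E·M·h` is free).  Members beyond the suspensions (`E = M = 1`): the pinch-type germs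
`x₀·x₂^d + h(x₀,x₁)`, `E·(x₂^d + h)`, … [OURS · L1 W4.3] -/
theorem tot_relBinomial_plane : ∀ (p : ℕ) (_ : p.Prime) (k : Type) [Field k] [CharP k p] [IsAlgClosed k] (d : ℕ)
    (E M h : MvPowerSeries (Fin 2) k), E ≠ 0 → M ≠ 0 → h ≠ 0 → IsUnit ((d : ℕ) : k) →
    ∃ n, WinsIn (m := 2) GermIsNC n (rename Fin.castSucc E * (rename Fin.castSucc M * X 2 ^ d + rename Fin.castSucc h)) :=
  fun _ _ k _ _ _ _ _ _ _ hE hM hh hd =>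
    exists_winsIn_relBinom (m := 1) (r := 0) (M := 2) rfl (toricStep 2) (toricEnd 2) (orderGrowth 2) hd.ne_zero hE hM hh
      (winsIn_plane k _ (mul_ne_zero (mul_ne_zero hE hM) hh))

/-! ## Won-level consequences: double points over tame suspensions, and the census specimen -/

/-- Orders of pure powers of a variable. -/
theorem order_X_pow' {n : ℕ} (s : Fin n) (e : ℕ) : ((X s : MvPowerSeries (Fin n) k) ^ e).order = e := by
  rw [X_pow_eq, order_monomial_of_ne_zero one_ne_zero, Finsupp.degree_single]

/-- Renaming along `Fin.castSucc` does not lower the order (`rename = subst (X ∘ castSucc)`, Mathlib's `le_order_subst`). -/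
theorem le_order_rename_castSucc {n : ℕ} (c : MvPowerSeries (Fin n) k) :
    c.order ≤ (rename Fin.castSucc c : MvPowerSeries (Fin (n + 1)) k).order := by
  rw [rename_eq_subst]
  have h := MvPowerSeries.le_order_subst (MvPowerSeries.HasSubst.X_comp (R := k) (Fin.castSucc (n := n))) c
  have h1 : (1 : ℕ∞) ≤ ⨅ i : Fin n, ((X ∘ Fin.castSucc) i : MvPowerSeries (Fin (n + 1)) k).order := by
    refine le_iInf fun i => ?_
    rw [Function.comp_apply, X_def, order_monomial_of_ne_zero (one_ne_zero' k), Finsupp.degree_single, Nat.cast_one]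
  calc c.order = 1 * c.order := (one_mul _).symm
    _ ≤ (⨅ i : Fin n, ((X ∘ Fin.castSucc) i : MvPowerSeries (Fin (n + 1)) k).order) * c.order := by gcongr
    _ ≤ _ := h

/-- `ord (x₂^m + c) ≥ 2` for `m ≥ 2`, `ord c ≥ 2`. -/
theorem two_le_order_suspension {m : ℕ} (h2m : 2 ≤ m) {c : MvPowerSeries (Fin 2) k} (hc2 : (2 : ℕ∞) ≤ c.order) :
    (2 : ℕ∞) ≤ (X 2 ^ m + rename Fin.castSucc c : MvPowerSeries (Fin 3) k).order :=
  le_trans (le_min (by rw [order_X_pow']; exact_mod_cast h2m) (le_trans hc2 (le_order_rename_castSucc c))) min_order_le_add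

/-- **DOUBLE POINTS OVER TAME SUSPENSIONS ARE WON IN FOUR VARIABLES** (characteristic `≠ 2`): for `m ≥ 2` invertible in `k` and a non-zero
plane germ `c` of order `≥ 2`, the germ `y² + x₂^m + c(x₀,x₁)` is `Won k 4` — res-L1-w43-stub-3's `won_doublePoint_of_winsIn` (F-D, the
prepared-germ multiplier at multiplicity `2`) over `tot_suspension_tame`. [OURS · L1 W4.3] -/
theorem won_four_doublePoint_suspension (p : ℕ) (hp : p.Prime) (k : Type) [Field k] [CharP k p] [IsAlgClosed k]
    (h2 : (2 : k) ≠ 0) (m : ℕ) (hm : IsUnit ((m : ℕ) : k)) (h2m : 2 ≤ m) (c : MvPowerSeries (Fin 2) k) (hc : c ≠ 0)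
    (hc2 : (2 : ℕ∞) ≤ c.order) :
    Won k 4 (X (Fin.last 3) ^ 2 + rename (Fin.succAboveEmb (Fin.last 3)) (X 2 ^ m + rename Fin.castSucc c : MvPowerSeries (Fin 3) k)) :=
  won_doublePoint_of_winsIn p hp k 2 h2 _ (tameSuspension_ne_zero (fun h => hm.ne_zero (by rw [h, Nat.cast_zero])) c)
    (two_le_order_suspension h2m hc2) (tot_suspension_tame p hp k m c hc hm)

/-- The letter `x₂` is not in the image of `Fin.castSucc : Fin 2 → Fin 3`. -/
theorem two_not_mem_range_castSuccEmb : (2 : Fin 3) ∉ Set.range (Fin.castSuccEmb (n := 2)) := by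
  rintro ⟨i, hi⟩
  fin_cases i <;> exact absurd hi (by decide)

/-- An `x₂`-binomial over the plane with `E, h ≠ 0`, `d ≠ 0` is non-zero (kill `x₂`: Mathlib's `killCompl`). -/
theorem relBinomial_plane_ne_zero {d : ℕ} (hd : d ≠ 0) {E h : MvPowerSeries (Fin 2) k} (M : MvPowerSeries (Fin 2) k) (hE : E ≠ 0)
    (hh : h ≠ 0) : (rename Fin.castSucc E * (rename Fin.castSucc M * X 2 ^ d + rename Fin.castSucc h) : MvPowerSeries (Fin 3) k) ≠ 0 := by
  refine mul_ne_zero (fun h0 => hE (rename_injective Fin.castSuccEmb (by rw [map_zero]; exact h0))) fun h0 => hh ?_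
  have hk := congrArg (killCompl (R := k) (Fin.castSuccEmb (n := 2))) h0
  have hM' : killCompl (R := k) (Fin.castSuccEmb (n := 2)) (rename Fin.castSucc M) = M := killCompl_rename_app M
  have hh' : killCompl (R := k) (Fin.castSuccEmb (n := 2)) (rename Fin.castSucc h) = h := killCompl_rename_app h
  rwa [map_add, map_mul, map_pow, hM', hh', killCompl_X_eq_zero two_not_mem_range_castSuccEmb, zero_pow hd, mul_zero, zero_add,
    map_zero] at hk

/-- **DOUBLE POINTS OVER `x₂`-BINOMIALS ARE WON IN FOUR VARIABLES** (characteristic `≠ 2`): `y² + E·(M·x₂^d + h)` for non-zero plane germs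
`E, M, h`, `d` invertible in `k`, total order `≥ 2` — F-D's `won_doublePoint_of_winsIn` over `tot_relBinomial_plane`. [OURS · L1 W4.3] -/
theorem won_four_doublePoint_relBinomial (p : ℕ) (hp : p.Prime) (k : Type) [Field k] [CharP k p] [IsAlgClosed k]
    (h2 : (2 : k) ≠ 0) (d : ℕ) (hd : IsUnit ((d : ℕ) : k)) (E M h : MvPowerSeries (Fin 2) k) (hE : E ≠ 0) (hM : M ≠ 0) (hh : h ≠ 0)
    (hord : (2 : ℕ∞) ≤ (rename Fin.castSucc E * (rename Fin.castSucc M * X 2 ^ d + rename Fin.castSucc h) : MvPowerSeries (Fin 3) k).order) :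
    Won k 4 (X (Fin.last 3) ^ 2 + rename (Fin.succAboveEmb (Fin.last 3))
      (rename Fin.castSucc E * (rename Fin.castSucc M * X 2 ^ d + rename Fin.castSucc h) : MvPowerSeries (Fin 3) k)) :=
  won_doublePoint_of_winsIn p hp k 2 h2 _
    (relBinomial_plane_ne_zero (fun h0 => hd.ne_zero (by rw [h0, Nat.cast_zero])) M hE hh) hord
    (tot_relBinomial_plane p hp k d E M h hE hM hh hd)

/-- **RADICAL CLOSURE**: every divisor of a power of an `x₂`-binomial over the plane (`E, M, h ≠ 0`, `d` invertible in `k`) is finitely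
NC-winnable — radical transport `winsIn_of_dvd_pow` with the heredity (N1) `germIsNC_of_dvd_pow` of normal-crossing support. -/
theorem winsIn_of_dvd_relBinomial_plane_pow (p : ℕ) (hp : p.Prime) (k : Type) [Field k] [CharP k p] [IsAlgClosed k]
    (d : ℕ) (hd : IsUnit ((d : ℕ) : k)) (E M h : MvPowerSeries (Fin 2) k) (hE : E ≠ 0) (hM : M ≠ 0) (hh : h ≠ 0) (N : ℕ)
    (b : MvPowerSeries (Fin 3) k) (hb : b ∣ (rename Fin.castSucc E * (rename Fin.castSucc M * X 2 ^ d + rename Fin.castSucc h)) ^ (N + 1)) :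
    ∃ n, WinsIn (m := 2) GermIsNC n b := by
  obtain ⟨n, hn⟩ := tot_relBinomial_plane p hp k d E M h hE hM hh hd
  exact ⟨n, winsIn_of_dvd_pow (fun N b d hd hnc hbd => germIsNC_of_dvd_pow N b d hd hnc hbd) n N b _
    (relBinomial_plane_ne_zero (fun h0 => hd.ne_zero (by rw [h0, Nat.cast_zero])) M hE hh) hn hb⟩

/-- **THE N = 4 CONSUMER (census shape, every tame multiplicity)**: a germ `f ∈ k⟦x₀,…,x₃⟧` with a presentation `f ∘ θ = U·y^{e+2} + Σ a_j y^j`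
(`θ` legal, `U(0) ≠ 0`, `a` bad, `(e + 2 : k) ≠ 0`) whose support product `∏_{a_j ≠ 0} a_j` divides a power of an `x₂`-binomial over the plane
is `Won k 4`, given the singular germs of order `< e + 2` — res-L1-w43-stub-3's F-D `won_four_of_presentation_winsIn` over
`winsIn_of_dvd_relBinomial_plane_pow`.  (The shape in which (K-c)/(K-c′) enter `stub_tameWideApexFourStartsWon` via `stub_tschirnhausForm`.)
[OURS · L1 W4.3] -/
theorem won_four_of_presentation_dvd_relBinomial_pow (p : ℕ) (hp : p.Prime) (k : Type) [Field k] [CharP k p]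
    [IsAlgClosed k] (e : ℕ) (he : ((e + 2 : ℕ) : k) ≠ 0)
    (hlow : ∀ G : MvPowerSeries (Fin 4) k, IsSingular k G → G.order < ((e + 2 : ℕ) : ℕ∞) → Won k 4 G)
    (f : MvPowerSeries (Fin 4) k) (θ : Fin 4 → MvPowerSeries (Fin 4) k) (U : MvPowerSeries (Fin 4) k)
    (a : Fin (e + 1) → MvPowerSeries (Fin 3) k) (hθ0 : ∀ i, constantCoeff (θ i) = 0)
    (hθdet : IsUnit (Matrix.det (Matrix.of fun i j => coeff (Finsupp.single j 1) (θ i)))) (hU : constantCoeff U ≠ 0)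
    (hBad : TupleGame.Bad a) (hθf : subst θ f = TupleGame.germ U a) (d : ℕ) (hd : IsUnit ((d : ℕ) : k))
    (E M h : MvPowerSeries (Fin 2) k) (hE : E ≠ 0) (hM : M ≠ 0) (hh : h ≠ 0) (N : ℕ)
    (hsupp : TupleGame.prodSupport a ∣ (rename Fin.castSucc E * (rename Fin.castSucc M * X 2 ^ d + rename Fin.castSucc h)) ^ (N + 1)) :
    Won k 4 f :=
  won_four_of_presentation_winsIn p hp k e he hlow f θ U a hθ0 hθdet hU hBad hθf
    (Or.inr (winsIn_of_dvd_relBinomial_plane_pow p hp k d hd E M h hE hM hh N _ hsupp))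

/-- The plane germ `(x₀² − x₁³)²` of the specimen has order `4`. -/
theorem order_cuspSq : (((X 0 : MvPowerSeries (Fin 2) k) ^ 2 - X 1 ^ 3) ^ 2).order = 4 := by
  have h1 : ((X 0 : MvPowerSeries (Fin 2) k) ^ 2 - X 1 ^ 3).order = 2 := by
    rw [sub_eq_add_neg, order_add_of_order_ne] <;> rw [order_neg, order_X_pow', order_X_pow'] <;> decide
  rw [pow_two, MvPowerSeries.order_mul, h1]; rfl

/-- **THE POST-R6 CENSUS SPECIMEN IS WON**: for `p ≥ 5` the suspended-cusp germ `y² + x₂³ + (x₀² − x₁³)²` — singular along the cusp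
`{y = x₂ = 0, x₀² = x₁³}`, its coefficient `x₂³ + (x₀² − x₁³)²` neither a cylinder nor Newton non-degenerate (N4-TAME-CENSUS v1.1, the first
germ beyond rung R6) — is `Won k 4`: `won_four_doublePoint_suspension` at `m = 3`, `c = (x₀² − x₁³)²`. [OURS · L1 W4.3] -/
theorem specimen_suspendedCusp_won (p : ℕ) (hp : p.Prime) [CharP k p] [IsAlgClosed k] (h5 : 5 ≤ p) :
    Won k 4 ((X 3 : MvPowerSeries (Fin 4) k) ^ 2 + X 2 ^ 3 + (X 0 ^ 2 - X 1 ^ 3) ^ 2) := by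
  have hne : ∀ q : ℕ, 0 < q → q < p → ((q : ℕ) : k) ≠ 0 := fun q hq hqp h0 =>
    Nat.not_dvd_of_pos_of_lt hq hqp ((CharP.cast_eq_zero_iff k p q).mp h0)
  have h2 : (2 : k) ≠ 0 := by exact_mod_cast hne 2 two_pos (by omega)
  have h3 : IsUnit (((3 : ℕ) : ℕ) : k) := (hne 3 three_pos (by omega)).isUnit
  have hc4 := order_cuspSq (k := k)
  have hc : ((X 0 : MvPowerSeries (Fin 2) k) ^ 2 - X 1 ^ 3) ^ 2 ≠ 0 := fun h0 => by
    rw [h0, order_zero] at hc4; exact ENat.top_ne_coe 4 hc4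
  have h := won_four_doublePoint_suspension p hp k h2 3 h3 (by omega) _ hc (by rw [hc4]; decide)
  have heq : (X (Fin.last 3) ^ 2 + rename (Fin.succAboveEmb (Fin.last 3))
      (X 2 ^ 3 + rename Fin.castSucc (((X 0 : MvPowerSeries (Fin 2) k) ^ 2 - X 1 ^ 3) ^ 2) : MvPowerSeries (Fin 3) k) :
        MvPowerSeries (Fin 4) k) = X 3 ^ 2 + X 2 ^ 3 + (X 0 ^ 2 - X 1 ^ 3) ^ 2 := by
    simp only [map_add, map_pow, map_sub, rename_X, ← add_assoc]
    rfl
  rwa [heq] at h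

end TameN4

end Summit.ResolutionOfSingularities.ResolutionOfSingularities.Theorems
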